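import Summits.AtomisticToContinuum.HydrodynamicLimit.Theorems.LambertianContactSwapLambertianEulerDockRf
import HarnessLib

/-!
# The entropy-clock dock of the Lambertian gas along the EXPLICIT reference, PACKING-GUARDED (crux `LambertianEuler`, stmt-AtomisticToContinuum-11854, line `Sketch`, stub `stub_dockLambdaRfInBand`)

Stub `stub_dockLambdaRfInBand` of the crux `LambertianEuler` (Euler hydrodynamic limit of the Lambertian
hard-sphere gas `Λ`, law of `Λ_t` under `λ_N ⊗ γ^ℕ`, `lambertFlow` / `lambertNoise`). This file is the
PACKING-GUARDED port of the dock along the explicit reference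
`LambertianContactSwapLambertianEulerDockRf.stub_dockLambdaRf` (lead c7, decision D-0032): the
dilute-self-consistency premise `DiluteSelfConsistency` (packing `ρ_t σ³ < η` for EVERY `η > 0` along tied
classical solutions) of the `Rf`-dock is REPLACED by a packing GUARD. The hypothesis is Yau's relative-entropy
estimate along the explicit reference family `a_t := fun x => ρ t x * Rf (σ ^ 3 * ρ t x)`, for EVERY insertion
factor `Rf` on `(-r, r)` (handed over with its four defining properties `Rf x · Φ(x Rf x) = 1` and `0 < Rf` on
`(-r, r)`, `1 ≤ Rf ≤ 2` and continuity on `[0, r]`, uniqueness of the root in `[1/2, 2]`), INSIDE A BAND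
`ηg > 0` (depending on `Rf`): it is only asserted for classical solutions with `ρ_t σ³ < ηg` on `[0, T)`. The
conclusion is Yau's node `RelEntropyVanishingLambda` GUARDED by a band `η₀' > 0`: the local Gibbs laws are
probability measures and, given the `t = 0` tie, for every classical solution with `ρ_t σ³ < η₀'` on `[0, T)`
and every `t ∈ [0, T)` there is an activity profile `a` whose local Gibbs law with `(u t, θ t)` is a
probability measure, concentrates exponentially around the Euler fields `(ρ t, u t, θ t)`, and
`KL(law of Λ_t ‖ that reference)/(N+1) → 0`.

Proof route: the proof of `LambertianContactSwapLambertianEulerDockRf.stub_dockLambdaRf` transfers verbatim,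
the single substantive use of `DiluteSelfConsistency` (the packing `ρ_t σ³ < min η₁ (η₀/2)` at `t > 0`) being
read off the guard instead:

* the insertion factor is the analytic one of the tree (`stub_eosRatioAnalytic`; continuity on `[0, r]`
  from its Lipschitz clause), the matrix `HU η₀` of `UniformLocalGibbsConcentration` is taken from the
  tree (`twoClocks_uniformLocalGibbsConcentration_proof`), the Gronwall band `ηg` from the hypothesis;
* the guard band is `η₀' := min ηg (min η₁ (η₀/2))`, `η₁ := min (r/(8e+4)) (1/(64 e v₁))` the packing
  threshold of `EntropyClockDock.activity_of_density`; below `ηg` it feeds the Gronwall hypothesis, below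
  `min η₁ (η₀/2)` it is the packing of `ρ_t`;
* `σ₀ := min σc (min (1/2) (η₀ ∫a₀ / sup a₀))` (`σc` from the hypothesis); the probability clause holds for
  `σ ≤ 1/2`;
* at `t = 0` the law of `Λ_0` under `λ_N ⊗ γ^ℕ` IS `λ_N`, so the deterministic `t = 0` slice transfers
  (`LambertianContactSwapLambertianEulerDock.lambert_timeZero_slice`);
* at `t > 0`: mass conservation and unit admissible mass (private re-proofs `integral_density_eq`,
  `integral_density_zero_eq_one`), packing of `ρ_t` (the guard), the EXPLICIT inverted activity `a_t`
  (`EntropyClockDock.activity_of_density`: `ρ_t ≤ a_t ≤ 2ρ_t`, `SmallDensity (profileOf a_t) σ`,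
  `rhoLim (profileOf a_t) σ = ρ_t`), its `η₀`-diluteness, the reference tie
  (`EntropyClockDock.tie_rhoLim_of_smallDensity`), exponential concentration of the reference around an
  anonymous density pinned to `ρ_t` by `EntropyClockDock.data_eq_of_ties` /
  `EntropyClockDock.tie_of_expConc`, and the KL clause from the hypothesis (fed the guard at level `ηg`).

References: H.-T. Yau, Lett. Math. Phys. 22 (1991); S. Olla, S. R. S. Varadhan, H.-T. Yau, Comm. Math.
Phys. 155 (1993) §3; C. Kipnis, C. Landim, Scaling Limits of Interacting Particle Systems (1999) Ch. 6;
H. Spohn, Large Scale Dynamics of Interacting Particles (1991) Part I §2.3.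

prover-line-stmt-AtomisticToContinuum-11854 (lead c7), line Sketch, stub `stub_dockLambdaRfInBand`.
-/

noncomputable section

namespace Summit.AtomisticToContinuum.HydrodynamicLimit.Theorems.LambertianContactSwapLambertianEulerDockRfInBand

open scoped BigOperators Topology ENNReal InnerProductSpace
open MeasureTheory ProbabilityTheory Filter Set InformationTheory
open Literature.MathematicalPhysics.KineticTheory
open Literature.Analysis.FluidPDE Literature.Analysis.FluidPDE.Alexander

/-! ### §1 Mass conservation and unit admissible mass (PRIVATE re-proofs) -/

open Literature.Analysis.FunctionSpaces in
-- adapted from `LambertianContactSwapLambertianEulerDockRf.integral_density_eq` (Theorems/LambertianContactSwapLambertianEulerDockRf.lean,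
-- private; itself adapted from `EntropyClockDock.integral_density_eq`, Theorems/TwoClocksClampedWindowDockGronwall.lean)
/-- **Mass is conserved** along every classical hard-sphere-Euler solution: `∫ ρ(t) = ∫ ρ(0)` on `[0, T)` (only
the continuity equation is integrated, `∫ div = 0` on the torus). [folklore] -/
private theorem integral_density_eq {σ T : ℝ} {ρ θ : ℝ → T3 → ℝ} {u : ℝ → T3 → V3}
    (hE : IsHardSphereEulerSolution σ T ρ u θ) {t : ℝ} (ht : t ∈ Ico 0 T) :
    ∫ x, ρ t x = ∫ x, ρ 0 x := by
  have hderiv : ∀ s ∈ Ico 0 T, HasDerivWithinAt (fun s => ∫ x, ρ s x) 0 (Ico 0 T) s := by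
    intro s hs
    have h1 := hE.smooth_density.hasDerivWithinAt_integral (convex_Ico 0 T) hs
    have h2 : ∫ x, Torus.timeDerivWithin (Ico 0 T) ρ s x = 0 := by
      have hpt : (fun x => Torus.timeDerivWithin (Ico 0 T) ρ s x) =
          fun x => -Torus.divergence (fun y => ρ s y • u s y) x := by
        funext x; have := hE.mass s hs x; linarith
      rw [hpt, integral_neg, neg_eq_zero]
      exact Torus.integral_divergence_eq_zero_holds
        ((hE.smooth_density.smul hE.smooth_velocity).isSmooth_slice hs)
    rwa [h2] at h1
  have hcont : ContinuousOn (fun s => ∫ x, ρ s x) (Icc 0 t) := fun s hs =>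
    ((hderiv s ⟨hs.1, hs.2.trans_lt ht.2⟩).continuousWithinAt).mono (Icc_subset_Ico_right ht.2)
  have hright : ∀ s ∈ Ico 0 t, HasDerivWithinAt (fun s => ∫ x, ρ s x) 0 (Ici s) s := by
    intro s hs
    have hsT : s ∈ Ico 0 T := ⟨hs.1, hs.2.trans ht.2⟩
    refine (hderiv s hsT).mono_of_mem_nhdsWithin ?_
    exact Filter.mem_of_superset (Ico_mem_nhdsGE hsT.2) (Ico_subset_Ico_left hsT.1)
  exact constant_of_has_deriv_right_zero hcont hright t (right_mem_Icc.2 ht.1)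

-- adapted from `LambertianContactSwapLambertianEulerDockRf.integral_density_zero_eq_one` (ibid., private; itself
-- adapted from `EntropyClockDock.integral_density_zero_eq_one`)
/-- **Admissible mass is one**: the `t = 0` tie tested with `χ ≡ 1` (empirical density identically `1`, laws of
total mass `1` for `σ ≤ 1/2`) forces `∫ ρ(0) = 1`. [folklore] -/
private theorem integral_density_zero_eq_one {σ : ℝ} (hσ2 : σ ≤ 1 / 2) {a₀ θ₀ : T3 → ℝ} {u₀ : T3 → V3}
    (ha : Continuous a₀) (hθ : Continuous θ₀) (hu : Continuous u₀) (ha0 : ∀ x, 0 < a₀ x)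
    (hθ0 : ∀ x, 0 < θ₀ x) {ρ θ : ℝ → T3 → ℝ} {u : ℝ → T3 → V3}
    (Φ : (N : ℕ) → HardSphereFlow (Torus.geometry (Fin 3)) (hsDiameter σ N) (N + 1))
    (hA : TendstoHydroFieldsAt (fun N => localGibbsLaw σ a₀ u₀ θ₀ N (Φ N)) Φ ρ u θ 0) :
    ∫ x, ρ 0 x = 1 := by
  by_contra hne
  have hd : 0 < |1 - ∫ x, ρ 0 x| := abs_pos.2 (sub_ne_zero.2 (Ne.symm hne))
  have h := (hA (fun _ => 1) continuous_const (|1 - ∫ x, ρ 0 x| / 2) (by positivity)).1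
  have hev : ∀ N : ℕ, {z : Config (N + 1) (Fin 3) T3 | |1 - ∫ x, ρ 0 x| / 2 <
      |empiricalDensityField ((Φ N).flow 0 z) (fun _ => 1) - ∫ x, (fun _ => (1 : ℝ)) x * ρ 0 x|} = univ := by
    intro N
    ext z
    simp only [mem_setOf_eq, mem_univ, iff_true, empiricalDensityField_one (Nat.succ_ne_zero N), one_mul]
    linarith
  have hP : ∀ N, IsProbabilityMeasure (localGibbsLaw σ a₀ u₀ θ₀ N (Φ N)) :=
    fun N => isProbabilityMeasure_localGibbsLaw ha hθ hu ha0 hθ0 hσ2 N (Φ N)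
  simp only [hev, measure_univ] at h
  exact one_ne_zero (tendsto_nhds_unique (tendsto_const_nhds (x := (1 : ℝ≥0∞)) (f := atTop)) h)

/-! ### §2 The packing-guarded dock along the explicit reference: `GronwallCoreLambdaRf (in band) → RelEntropyVanishingLambda (in band)` -/

/-- **The entropy-clock DOCK of the Lambertian gas along the EXPLICIT reference, PACKING-GUARDED** (stub
`stub_dockLambdaRfInBand` of line `Sketch`): the packing-guarded form of Yau's node
`RelEntropyVanishingLambda` — there is a band `η₀' > 0` such that for continuous positive profiles there is
`σ₀ > 0` such that for `0 < σ < σ₀`, every classical solution with `ρ_t σ³ < η₀'` on `[0, T)` and every flow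
family `Φ`, the local Gibbs laws are probability measures and, given the `t = 0` tie, for every `t ∈ [0, T)`
some activity profile `a` gives a probability reference with `(u t, θ t)` that concentrates exponentially
around the Euler fields and carries vanishing specific relative entropy of the law of `Λ_t` under
`λ_N ⊗ γ^ℕ` — follows from Yau's relative-entropy estimate along the explicit reference family INSIDE A BAND:
for EVERY insertion factor `Rf` on `(-r, r)` (handed over with `Rf x · Φ(x Rf x) = 1` and `0 < Rf` on
`(-r, r)`, `1 ≤ Rf ≤ 2` and continuity on `[0, r]`, uniqueness of the root of `R · Φ(xR) = 1` in `[1/2, 2]`)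
there is `ηg > 0` such that for continuous positive profiles there is `σ₀ > 0` such that for `0 < σ < σ₀`,
every classical solution with `ρ_t σ³ < ηg` on `[0, T)`, every flow family `Φ` tied at `t = 0`, every
`t ∈ (0, T)`, with `a_t := fun x => ρ t x * Rf (σ ^ 3 * ρ t x)` continuous, positive, `ρ_t ≤ a_t ≤ 2ρ_t`,
`SmallDensity (profileOf a_t) σ`, `rhoLim (profileOf a_t) σ = ρ_t`, the specific relative entropy of the law
of `Λ_t` with respect to `localGibbsLaw σ a_t (u t) (θ t) N (Φ N)` vanishes. Discharged here: the insertion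
factor (`stub_eosRatioAnalytic`), the guard band `η₀' := min ηg (min η₁ (η₀/2))` (`η₀` of
`twoClocks_uniformLocalGibbsConcentration_proof`, `η₁` the packing threshold of
`EntropyClockDock.activity_of_density`), the probability clause (`σ ≤ 1/2`), the `t = 0` slice
(`lambert_timeZero_slice`), the choice of `σ₀`, mass conservation and unit mass, the explicit inverted
activity (`EntropyClockDock.activity_of_density`) with its `η₀`-diluteness and its tie
(`EntropyClockDock.tie_rhoLim_of_smallDensity`), and the exponential concentration of the reference around
the Euler fields (the matrix of `UniformLocalGibbsConcentration` from the tree, its anonymous density pinned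
to `ρ_t` by `EntropyClockDock.data_eq_of_ties`). Packing-guarded port (D-0032) of
`LambertianContactSwapLambertianEulerDockRf.stub_dockLambdaRf`. [folklore] -/
theorem stub_dockLambdaRfInBand : (∀ (r : ℝ) (Rf : ℝ → ℝ), 0 < r → (∀ x ∈ Set.Ioo (-r) r, 0 < Rf x ∧ Rf x * (∑' j : ℕ, bE j / (j.factorial : ℝ) * (x * Rf x) ^ j) = 1) → (∀ x ∈ Set.Icc 0 r, 1 ≤ Rf x ∧ Rf x ≤ 2) → ContinuousOn Rf (Set.Icc 0 r) → (∀ x ∈ Set.Ioo (-r) r, ∀ R ∈ Set.Icc (1 / 2 : ℝ) 2, R * (∑' j : ℕ, bE j / (j.factorial : ℝ) * (x * R) ^ j) = 1 → R = Rf x) → ∃ ηg : ℝ, 0 < ηg ∧ ∀ (a₀ θ₀ : T3 → ℝ) (u₀ : T3 → V3), Continuous a₀ → Continuous θ₀ → Continuous u₀ → (∀ x, 0 < a₀ x) → (∀ x, 0 < θ₀ x) → ∃ σ₀ : ℝ, 0 < σ₀ ∧ ∀ σ : ℝ, 0 < σ → σ < σ₀ → ∀ (T : ℝ) (ρ θ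 : ℝ → T3 → ℝ) (u : ℝ → T3 → V3), IsHardSphereEulerSolution σ T ρ u θ → (∀ t ∈ Set.Ico 0 T, ∀ x, ρ t x * σ ^ 3 < ηg) → ∀ Φ : (N : ℕ) → HardSphereFlow (Torus.geometry (Fin 3)) (hsDiameter σ N) (N + 1), TendstoHydroFieldsAt (fun N => localGibbsLaw σ a₀ u₀ θ₀ N (Φ N)) Φ ρ u θ 0 → ∀ t ∈ Set.Ioo 0 T, ∀ (hac : Continuous fun x => ρ t x * Rf (σ ^ 3 * ρ t x)) (hap : ∀ x, 0 < ρ t x * Rf (σ ^ 3 * ρ t x)), (∀ x, ρ t x ≤ ρ t x * Rf (σ ^ 3 * ρ t x) ∧ ρ t x * Rf (σ ^ 3 * ρ t x) ≤ 2 * ρ t x) → SmallDensity (profileOf (fun x => ρ t x * Rf (σ ^ 3 * ρ t x)) hac hap) σ → rhoLim (profileOf (fun x => ρ t x * Rf (σ ^ 3 * ρ t x)) hac hap) σ = ρ t → Tendsto (fun N : ℕ => klDiv (((localGibbsLaw σ a₀ u₀ θ₀ N (Φ N)).prod (lambertNoise (Fin 3))).map (fun p => lambertFlow (Torus.geometry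 (Fin 3)) (hsDiameter σ N) p.2 p.1 t)) (localGibbsLaw σ (fun x => ρ t x * Rf (σ ^ 3 * ρ t x)) (u t) (θ t) N (Φ N)) / ((N : ℝ≥0∞) + 1)) atTop (𝓝 0)) → ∃ η₀ : ℝ, 0 < η₀ ∧ ∀ (a₀ θ₀ : T3 → ℝ) (u₀ : T3 → V3), Continuous a₀ → Continuous θ₀ → Continuous u₀ → (∀ x, 0 < a₀ x) → (∀ x, 0 < θ₀ x) → ∃ σ₀ : ℝ, 0 < σ₀ ∧ ∀ σ : ℝ, 0 < σ → σ < σ₀ → ∀ (T : ℝ) (ρ θ : ℝ → T3 → ℝ) (u : ℝ → T3 → V3), IsHardSphereEulerSolution σ T ρ u θ → (∀ t ∈ Set.Ico 0 T, ∀ x, ρ t x * σ ^ 3 < η₀) → ∀ Φ : (N : ℕ) → HardSphereFlow (Torus.geometry (Fin 3)) (hsDiameter σ N) (N + 1), (∀ N, IsProbabilityMeasure (localGibbsLaw σ a₀ u₀ θ₀ N (Φ N))) ∧ (TendstoHydroFieldsAt (fun N => localGibbsLaw σ a₀ u₀ θ₀ N (Φ N)) Φ ρ u θ 0 → ∀ t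 ∈ Set.Ico 0 T, ∃ a : T3 → ℝ, (∀ N, IsProbabilityMeasure (localGibbsLaw σ a (u t) (θ t) N (Φ N))) ∧ (∀ χ : T3 → ℝ, Continuous χ → ∀ δ : ℝ, 0 < δ → ∃ C : ℝ, 0 < C ∧ ∀ N : ℕ, localGibbsLaw σ a (u t) (θ t) N (Φ N) {z | δ < |empiricalDensityField z χ - ∫ x, χ x * ρ t x|} ≤ ENNReal.ofReal (C * Real.exp (-(C⁻¹ * (N + 1)))) ∧ localGibbsLaw σ a (u t) (θ t) N (Φ N) {z | δ < ‖empiricalMomentumField z χ - ∫ x, (χ x * ρ t x) • u t x‖} ≤ ENNReal.ofReal (C * Real.exp (-(C⁻¹ * (N + 1)))) ∧ localGibbsLaw σ a (u t) (θ t) N (Φ N) {z | δ < |empiricalEnergyField z χ - ∫ x, χ x * totalEnergyDensity (ρ t x) (u t x) (θ t x)|} ≤ ENNReal.ofReal (C * Real.exp (-(C⁻¹ * (N + 1))))) ∧ Tendsto (fun N : ℕ => klDiv (((localGibbsLaw σ a₀ u₀ θ₀ N (Φ N)).prod (lambertNoise (Fin 3))).map (fun p => lambertFlow (Torus.geometry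 (Fin 3)) (hsDiameter σ N) p.2 p.1 t)) (localGibbsLaw σ a (u t) (θ t) N (Φ N)) / ((N : ℝ≥0∞) + 1)) atTop (𝓝 0)) := by
  intro gronwall
  -- the analytic insertion factor of the hard-sphere gas
  obtain ⟨r, hr, Rf, -, -, -, hsol, hbd, hLip, huniq⟩ := stub_eosRatioAnalytic
  have hcont : ContinuousOn Rf (Icc 0 r) := by
    obtain ⟨L, hL⟩ := hLip
    exact hL.continuousOn
  -- the matrix of `UniformLocalGibbsConcentration` from the tree
  obtain ⟨η₀, hη₀, HU⟩ := twoClocks_uniformLocalGibbsConcentration_proof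
  -- the Gronwall band of the explicit reference `a_t = ρ_t · Rf(σ³ ρ_t)`
  obtain ⟨ηg, hηg, Hg⟩ := gronwall r Rf hr hsol hbd hcont huniq
  -- the packing threshold of `EntropyClockDock.activity_of_density`
  set η₁ : ℝ := min (r / (2 * (2 * (2 * Real.exp 1 + 1)))) (1 / (64 * Real.exp 1 * v₁)) with hη₁
  have hη₁ : 0 < η₁ := lt_min (by positivity) (by have := v₁_pos; positivity)
  -- the guard band of the conclusion: `η₀' := min ηg (min η₁ (η₀/2))`
  refine ⟨min ηg (min η₁ (η₀ / 2)), lt_min hηg (lt_min hη₁ (by positivity)),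
    fun a₀ θ₀ u₀ ha hθ hu ha0 hθ0 => ?_⟩
  obtain ⟨σc, hσc, Hc⟩ := Hg a₀ θ₀ u₀ ha hθ hu ha0 hθ0
  -- the initial activity is `η₀`-dilute for `σ ≤ min (1/2) (η₀ ∫a₀ / sup a₀)`
  have hI : 0 < ∫ x, a₀ x := integral_pos_of_continuous_pos ha ha0
  have hbdd₀ : BddAbove (Set.range a₀) := (isCompact_range ha).bddAbove
  have hSpos : 0 < ⨆ x, a₀ x := (ha0 0).trans_le (le_ciSup hbdd₀ 0)
  have hg : 0 < η₀ * (∫ x, a₀ x) / ⨆ x, a₀ x := div_pos (mul_pos hη₀ hI) hSpos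
  refine ⟨min σc (min (1 / 2) (η₀ * (∫ x, a₀ x) / ⨆ x, a₀ x)),
    lt_min hσc (lt_min (by norm_num) hg), fun σ hσ hσlt T ρ θ u hE hguard' Φ => ?_⟩
  have hσc' : σ < σc := hσlt.trans_le (min_le_left _ _)
  have hσ2' : σ < 1 / 2 := hσlt.trans_le ((min_le_right _ _).trans (min_le_left _ _))
  have hσ2 : σ ≤ 1 / 2 := hσ2'.le
  have hσg : σ ≤ η₀ * (∫ x, a₀ x) / ⨆ x, a₀ x :=
    (hσlt.trans_le ((min_le_right _ _).trans (min_le_right _ _))).le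
  have hguard : σ ^ 3 * (⨆ x, a₀ x) ≤ η₀ * ∫ x, a₀ x := by
    have h31 : σ ^ 3 ≤ σ := pow_le_of_le_one hσ.le (hσ2.trans (by norm_num)) three_ne_zero
    calc σ ^ 3 * (⨆ x, a₀ x) ≤ σ * ⨆ x, a₀ x := mul_le_mul_of_nonneg_right h31 hSpos.le
      _ ≤ η₀ * (∫ x, a₀ x) / (⨆ x, a₀ x) * ⨆ x, a₀ x := mul_le_mul_of_nonneg_right hσg hSpos.le
      _ = η₀ * ∫ x, a₀ x := div_mul_cancel₀ _ hSpos.ne'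
  -- the packing guard read at the Gronwall level `ηg`
  have hguardg : ∀ s ∈ Set.Ico 0 T, ∀ x, ρ s x * σ ^ 3 < ηg := fun s hs x =>
    (hguard' s hs x).trans_le (min_le_left _ _)
  refine ⟨fun N => isProbabilityMeasure_localGibbsLaw ha hθ hu ha0 hθ0 hσ2 N (Φ N), fun htie t ht => ?_⟩
  obtain ⟨ρ₀, hρ₀c, hρ₀pos, -, hconc⟩ := HU a₀ θ₀ u₀ ha hθ hu ha0 hθ0 σ hσ hguard
  rcases ht.1.eq_or_lt with h0 | htpos
  · subst h0
    exact LambertianContactSwapLambertianEulerDock.lambert_timeZero_slice hσ hσ2' ha hθ hu ha0 hθ0 hρ₀c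
      hρ₀pos hconc hE ht.2 Φ htie
  · -- the Euler slice at time `t`
    have hρtc : Continuous (ρ t) := (hE.smooth_density.isSmooth_slice ht).continuous
    have hutc : Continuous (u t) := (hE.smooth_velocity.isSmooth_slice ht).continuous
    have hθtc : Continuous (θ t) := (hE.smooth_temperature.isSmooth_slice ht).continuous
    have hρtpos : ∀ x, 0 < ρ t x := hE.density_pos t ht
    have hθtpos : ∀ x, 0 < θ t x := hE.temperature_pos t ht
    have hmass : ∫ x, ρ t x = 1 :=
      (integral_density_eq hE ht).trans (integral_density_zero_eq_one hσ2 ha hθ hu ha0 hθ0 Φ htie)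
    -- packing of `ρ_t`, read off the guard at the dock level `min η₁ (η₀/2)`
    have hpack : ∀ x, ρ t x * σ ^ 3 < min η₁ (η₀ / 2) := fun x =>
      (hguard' t ht x).trans_le (min_le_right _ _)
    have hbdd : BddAbove (Set.range (ρ t)) := (isCompact_range hρtc).bddAbove
    obtain ⟨xM, -, hxM⟩ := isCompact_univ.exists_isMaxOn univ_nonempty hρtc.continuousOn
    have hsup : (⨆ x, ρ t x) = ρ t xM :=
      le_antisymm (ciSup_le fun x => (isMaxOn_iff.mp hxM) x (mem_univ x)) (le_ciSup hbdd xM)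
    have hpack₁ : σ ^ 3 * (⨆ x, ρ t x) ≤ η₁ := by
      rw [hsup, mul_comm]; exact ((hpack xM).trans_le (min_le_left _ _)).le
    have hpack₀ : σ ^ 3 * (⨆ x, ρ t x) ≤ η₀ / 2 := by
      rw [hsup, mul_comm]; exact ((hpack xM).trans_le (min_le_right _ _)).le
    -- the EXPLICIT inverted activity `a_t = ρ_t · Rf(σ³ ρ_t)`
    obtain ⟨hac, hap, hale, hQs, hlim⟩ :=
      EntropyClockDock.activity_of_density hr hsol hbd hcont huniq hσ hσ2' hρtc hρtpos hmass hpack₁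
    -- `η₀`-diluteness of `a_t`: `σ³ sup a_t ≤ 2 σ³ sup ρ_t ≤ η₀ ≤ η₀ ∫a_t`
    have haguard : σ ^ 3 * (⨆ x, ρ t x * Rf (σ ^ 3 * ρ t x)) ≤
        η₀ * ∫ x, ρ t x * Rf (σ ^ 3 * ρ t x) := by
      have hsupa : (⨆ x, ρ t x * Rf (σ ^ 3 * ρ t x)) ≤ 2 * ⨆ x, ρ t x :=
        ciSup_le fun x => (hale x).2.trans (mul_le_mul_of_nonneg_left (le_ciSup hbdd x) zero_le_two)
      have hinta : 1 ≤ ∫ x, ρ t x * Rf (σ ^ 3 * ρ t x) := by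
        have h := integral_mono (integrable_of_continuous_T3 hρtc) (integrable_of_continuous_T3 hac)
          fun x => (hale x).1
        linarith [hmass]
      have hσ3 : 0 ≤ σ ^ 3 := by positivity
      calc σ ^ 3 * (⨆ x, ρ t x * Rf (σ ^ 3 * ρ t x)) ≤ σ ^ 3 * (2 * ⨆ x, ρ t x) :=
            mul_le_mul_of_nonneg_left hsupa hσ3
        _ = 2 * (σ ^ 3 * ⨆ x, ρ t x) := by ring
        _ ≤ 2 * (η₀ / 2) := by gcongr
        _ = η₀ * 1 := by ring
        _ ≤ η₀ * ∫ x, ρ t x * Rf (σ ^ 3 * ρ t x) := mul_le_mul_of_nonneg_left hinta hη₀.le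
    -- the reference: probability and exponential concentration around an anonymous density `ρ₁`
    obtain ⟨ρ₁, hρ₁c, hρ₁pos, hprob, hconc₁⟩ :=
      HU (fun x => ρ t x * Rf (σ ^ 3 * ρ t x)) (θ t) (u t) hac hθtc hutc hap hθtpos σ hσ haguard
    -- the reference tie: `rhoLim (profileOf a_t) σ = ρ_t`
    have hatie : TendstoHydroFieldsAt
        (fun N => localGibbsLaw σ (fun x => ρ t x * Rf (σ ^ 3 * ρ t x)) (u t) (θ t) N (Φ N)) Φ
        (fun _ => ρ t) (fun _ => u t) (fun _ => θ t) 0 := by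
      have h := EntropyClockDock.tie_rhoLim_of_smallDensity (u₀ := u t) hac hθtc hutc hap hθtpos hσ2 hQs Φ
      simp only [hlim] at h
      exact h
    -- pin the anonymous LLN density `ρ₁` of the reference to the Euler density `ρ t`
    obtain ⟨hρt, -, -⟩ := EntropyClockDock.data_eq_of_ties hσ2 Φ hac hθtc hutc hap hθtpos hρ₁c hρ₁pos
      (EntropyClockDock.tie_of_expConc Φ hconc₁) (ρ := fun _ => ρ t) (u := fun _ => u t)
      (θ := fun _ => θ t) hρtc hutc hθtc hatie
    refine ⟨fun x => ρ t x * Rf (σ ^ 3 * ρ t x), fun N => hprob N (Φ N), fun χ hχ δ hδ => ?_,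
      Hc σ hσ hσc' T ρ θ u hE hguardg Φ htie t ⟨htpos, ht.2⟩ hac hap hale hQs hlim⟩
    obtain ⟨C, hC, hN⟩ := hconc₁ χ hχ δ hδ
    refine ⟨C, hC, fun N => ?_⟩
    have h := hN N (Φ N)
    rw [← hρt] at h
    exact h

end Summit.AtomisticToContinuum.HydrodynamicLimit.Theorems.LambertianContactSwapLambertianEulerDockRfInBand

end
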